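import Literature.Barriers.CriticalPhenomena.SupercriticalSAWSpaceFillingDensityNecessary
import Literature.Barriers.CriticalPhenomena.SupercriticalSAWSpaceFillingBelowEight
import HarnessLib

/-!
# Barrier mechanism, fourteenth audit: the ONE-POINT form of the obstruction — an SLE_κ limit,
# `κ < 8`, forces vanishing visiting probabilities at every interior point; fugacity-ANNEALED
# laws whose prior charges the supercritical phase converge to no SLE_κ, `κ < 8`

Barrier catalogue `Literature/Barriers/CriticalPhenomena/` (D-0021); companion of
`SupercriticalSAWSpaceFillingProofs` (fourteenth audit, 2026-08-16, refuter, "barrier-audit"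
gen 14, of the mechanism file `…Proofs` of `SupercriticalSAWSpaceFilling` = Theorem 1 of
H. Duminil-Copin, G. Kozma, A. Yadin, *Supercritical self-avoiding walks are space-filling*,
Ann. IHP Probab. Stat. 50 (2014) 315–326, arXiv:1110.3074 — PROVED in the tree,
`SupercriticalSAWSpaceFilling_holds`; `blocks:` line unconditional,
`SupercriticalSAW.not_robustSAWScalingLimit`).

The mechanism of `…Proofs` / `…ProofsNarrow` / `…ProofsOnto` is GLOBAL: a weakly space-filling
family (every open set visited with probability `→ 1`) has almost surely ONTO limits, and no
chordal SLE_κ with `κ < 8` is onto. The ninth audit recorded in prose that fugacity-AVERAGED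
("annealed-in-`x`") laws `∫ P_{(𝔻_δ,a_δ,b_δ,x)} ρ(dx)` with `ρ((x_c, ∞)) = w > 0` — the costume
"the value of `μ(ℤ²)` is unknown, so draw the fugacity from a prior" — are obstructed in
substance although the one-sided portmanteau of `…Proofs` "bounds the limiting miss-functional
only by `1 - w`", by no declaration. This file proves a LOCAL, quantitative form of the
mechanism from which that obstruction (and more) follows:

* `measure_mem_range_sleTrace_eq_zero`, `measure_mem_range_eq_zero_of_isSLECurve` — for
  `0 < κ < 8` a chordal SLE_κ random curve of `(D; a, b)` almost surely misses every GIVEN point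
  `z ∈ D` (one-point estimate `P[dist(z, γ) ≤ ε] ≤ C (ε/Im z)^a`, Rohde–Schramm Thm 8.1 /
  Lemma 6.3, proved in the tree, transported through the uniformizing map: real parameters of
  the half-plane trace go to `∂D` by the half-plane Carathéodory theorem proved in the tree,
  `JordanDomain.exists_hasBoundaryValue_holds`, the terminal one to `b ∈ ∂D`, and `φ` is
  injective on `ℍ`); sharp in `κ` (for `κ ≥ 8` the trace is onto);
* `le_measure_mem_range_of_tendstoLaw` — **positive one-point density passes to the limit**: if
  at ONE point `z` every ball `B(z, r)` contains a visited mesh point with probability eventually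
  `≥ w`, every limit in law `Γ` of the polylines has `W[z ∈ trace Γ] ≥ w` (one-sided portmanteau
  with the bounded Lipschitz functional `visitFunctional z r = 1 - missFunctional z r` of
  `…Proofs`, then the events `{dist(z, trace Γ) < 2/(n+1)}` decrease to `{z ∈ trace Γ}`); the
  one-point analogue of `IsSpaceFillingLaws.ae_carrier_subset_range` (`w = 1` at every point);
* `exists_eventually_measure_visits_lt_of_convergesInLawToSLE` — **necessity**: an SLE_κ limit,
  `0 < κ < 8`, of ANY family of finite SAW laws forces, for every interior `z` and every `w > 0`,
  a radius `r > 0` with `P δ [γ_δ ∩ B(z, r) ≠ ∅] < w` for all small `δ`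
  (`lim_{r → 0} limsup_{δ → 0} P δ[γ_δ visits B(z,r)] = 0`); for the sub-problem,
  `exists_eventually_law_visits_lt_of_sawScalingLimit` — a Problem-10-type necessary condition
  at each point: it implies the weak non-space-filling asked for in Problem 10 (at every ball,
  with `liminf` of the avoidance probability positive) and complements the zero-density
  necessity of `…DensityNecessary`;
* `not_convergesInLawToSLE_of_le_measure_visits` — **the one-point obstruction**: a family
  visiting every ball around ONE interior point with probability eventually `≥ w > 0` converges
  to no chordal SLE_κ, `0 < κ < 8` (the space-filling mechanism is `w = 1` at all points;
  `not_convergesInLawToSLE_supercritical_unitDisc_onePoint` recovers the supercritical exclusion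
  of `…Unconditional`/`…BelowEight` from the centre of the disc alone);
* `annealedLaw ρ` (`= ∫ P_{(Ω_δ,a,b,x)} ρ(dx)`, `annealedLaw_apply`; `annealedLaw_dirac`:
  `ρ = δ_x` gives `P_x`), `eventually_le_annealedLaw` (Fatou: events of `P_x`-probability `→ 1`
  for `x ∈ I` have annealed probability eventually `≥ w` for every `w < ρ(I)`),
  `not_convergesInLawToSLE_annealed_unitDisc`, `not_forall_convergesInLawToSLE_annealed` — for a
  finite prior `ρ` with `ρ((x_c, ∞)) > 0` the annealed laws of `(𝔻; 1, -1)` (closest sites)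
  converge to no chordal SLE_κ, `0 < κ < 8`, and the annealed analogue of `SAWScalingLimit` is
  false: **the critical fugacity cannot be smeared upwards** — every prior under which the
  annealed walk has an SLE_{8/3} limit gives zero mass to the supercritical phase;
* the closed `Prop` `SupercriticalSAWSpaceFillingAnnealed` with `…_holds`.

Not covered, recorded: (a) priors charging the SUBCRITICAL phase, `ρ((0, x_c)) > 0` — dead in
substance (a `ρ((0,x_c))`-part of every limit is carried by rectifiable curves, the subcritical
walk having `O(1/δ)` steps, `…SubcriticalLength`, while an SLE_κ trace has dimension `> 1`
[cite: Beffara2008, Thm 1]) but the tree proves only the UPPER dimension bound for SLE, so a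
positive-probability rectifiable part is not excluded by a declaration; hence "SLE_κ (`κ < 8`)
limit of the `ρ`-annealed walk ⇒ `ρ((x_c, ∞)) = 0`" is what is machine-checked, not
"`ρ = δ_{x_c}`"; (b) `δ`-dependent priors `ρ_δ ⇒ δ_{x_c}` are window sequences of type (i) of
`SupercriticalSAWSpaceFillingNarrow`; (c) `κ ≥ 8`: the one-point hypothesis is satisfied by the
conjectured SLE₈ limit itself [cite: DuminilCopinKozmaYadin2014, Conjecture 11], so nothing
above `κ = 8` is obstructed by it, consistently with `…Phases`.

## Proof of the one-point step

Lattice side: a visited mesh point lies on the polyline, so on `{∃ v, δv ∈ B(z,r)}` the functional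
`V_{z,r}(γ.curve) = 1`, whence `P[visit B(z,r)] ≤ ∫ V_{z,r} dP` (`measureReal_visits_le_integral`).
Limit side: `V_{z,r} = 0` when `dist(z, trace) ≥ 2r`, so `∫ V_{z,r}(Γ) dW ≤ W[dist(z, trace Γ) < 2r]`
(`integral_visitFunctional_le_measureReal`). `TendstoLaw` equates the limits
(`le_measure_infDist_lt_of_tendstoLaw`), continuity from above along `r = 1/(n+1)` gives
`W[z ∈ trace Γ] ≥ w`, and for an SLE_κ curve, `κ < 8`, the left side is `0`. The annealed
instance: `P^ρ_δ[visit B(0,r)] = ∫ P_{x,δ}[visit B(0,r)] ρ(dx)`, and for `x > x_c` the integrand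
tends to `1` (Theorem 1, `DKY2014_thm1_holds`, through `isSpaceFillingFamily_of_DKY2014_thm1` and
`isProbabilityMeasure_lawAt`), so by Fatou along any sequence `δ_n → 0⁺` the annealed probability
is eventually `≥ ρ((x_c,∞))/2`.

No new hypothesis; axioms `propext`, `Classical.choice`, `Quot.sound`.

Mathlib: `Measure.sum_apply`, `Measure.dirac_apply'`, `Measure.tsum_indicator_apply_singleton`,
`lintegral_tsum`, `lintegral_liminf_le'`, `lintegral_indicator_one`, `lintegral_dirac'`,
`Filter.exists_seq_forall_of_frequently`, `Filter.liminf_le_of_le`, `Filter.Tendsto.liminf_eq`,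
`tendsto_measure_iInter_atTop`, `IsClosed.mem_iff_infDist_zero`, `ContinuousAt.rpow_const`,
`ENNReal.Tendsto.const_mul`, `SimpleGraph.Walk.support_injective`, `Function.Injective.countable`.

## References

* H. Duminil-Copin, G. Kozma, A. Yadin, Ann. IHP Probab. Stat. 50 (2014) 315–326,
  arXiv:1110.3074: §1 p. 2 ("for any open set `U ⊂ Ω`, `P_{(Ω_δ,a_δ,b_δ,x)}[γ_δ ∩ U = ∅] → 0`";
  Theorem 1), §4 p. 8 (Problems 9–10, Conjecture 11). [DuminilCopinKozmaYadin2014]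
* S. Rohde, O. Schramm, *Basic properties of SLE*, Ann. of Math. 161 (2005): Lemma 6.3 /
  eq. (6.2) and Thm 8.1 (one-point estimate); §7 (the space-filling phase `κ ≥ 8`). [RohdeSchramm2005]
* V. Beffara, *The dimension of the SLE curves*, Ann. Probab. 36 (2008), Thm 1. [Beffara2008]
* P. Billingsley, *Convergence of probability measures*, 2nd ed. (1999), Thm 2.1. [Billingsley1999]
-/

noncomputable section

open MeasureTheory Filter Topology Metric Set Literature.Probability.LatticeModels
  Literature.Probability.Percolation Literature.Probability.RandomPlanarGeometry
  Literature.Probability.RandomPlanarGeometry.SAW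
open scoped ENNReal NNReal BoundedContinuousFunction

namespace Literature.Barriers.CriticalPhenomena

namespace SupercriticalSAW

/-! ### Chordal SLE_κ, `κ < 8`, almost surely avoids every given interior point -/

section OnePoint

open UpperHalfPlane (upperHalfPlaneSet)
open Literature.Probability.Process (preWienerMeasure)

variable {κ : ℝ≥0}

/-- **A fixed point of `ℍ` is almost surely not on the SLE_κ trace, `0 < κ < 8`**: the event
`{z ∈ γ[0,∞)}` lies in `{dist(z, γ[0,∞)) ≤ ε}` for every `ε > 0`, whose probability is
`≤ C (ε / Im z)^a → 0` (`a = (1 - κ/8)/2`) by the one-point estimate of Rohde–Schramm proved in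
the tree (`measure_infDist_sleTrace_le`). [cite: RohdeSchramm2005, Thm 8.1] -/
theorem measure_mem_range_sleTrace_eq_zero (hκ0 : 0 < κ) (hκ8 : κ < 8) (hT : HasSLETrace κ)
    {z : ℂ} (hz : 0 < z.im) :
    preWienerMeasure {ω | z ∈ range (sleTrace κ ω)} = 0 := by
  have hκ8' : (κ : ℝ) < 8 := by exact_mod_cast hκ8
  set a : ℝ := (1 - (κ : ℝ) / 8) / 2 with ha
  have ha0 : 0 < a := by rw [ha]; linarith
  have ha1 : a < 1 - (κ : ℝ) / 8 := by rw [ha]; linarith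
  obtain ⟨C, hC⟩ := measure_infDist_sleTrace_le hκ0 ha0 ha1 hT
  have hle : ∀ ε : ℝ, 0 < ε → preWienerMeasure {ω | z ∈ range (sleTrace κ ω)} ≤
      C * ENNReal.ofReal ((ε / z.im) ^ a) := fun ε hε =>
    (measure_mono fun ω (hω : z ∈ range (sleTrace κ ω)) => by
      show infDist z (range (sleTrace κ ω)) ≤ ε
      rw [infDist_zero_of_mem hω]
      exact hε.le).trans (hC hz hε)
  have hlim : Tendsto (fun ε : ℝ => (C : ℝ≥0∞) * ENNReal.ofReal ((ε / z.im) ^ a))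
      (𝓝[>] 0) (𝓝 0) := by
    have h1 : Tendsto (fun ε : ℝ => (ε / z.im) ^ a) (𝓝[>] 0) (𝓝 0) := by
      have hc : ContinuousAt (fun ε : ℝ => (ε / z.im) ^ a) 0 :=
        ContinuousAt.rpow_const (continuousAt_id.div_const _) (Or.inr ha0.le)
      have h2 := hc.tendsto
      simp only [zero_div, Real.zero_rpow ha0.ne'] at h2
      exact h2.mono_left nhdsWithin_le_nhds
    have h2 := ENNReal.tendsto_ofReal h1
    rw [ENNReal.ofReal_zero] at h2
    have h3 := ENNReal.Tendsto.const_mul (a := (C : ℝ≥0∞)) h2 (Or.inr ENNReal.coe_ne_top)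
    rwa [mul_zero] at h3
  refine le_antisymm ?_ bot_le
  exact ge_of_tendsto hlim (eventually_nhdsWithin_of_forall fun ε hε => hle ε hε)

variable {D : DobrushinDomain} {Γ : (ℝ≥0 → ℝ) → CurveClass ℂ}

/-- **A chordal SLE_κ random curve of `(D; a, b)`, `0 < κ < 8`, almost surely misses every given
point `z ∈ D`.** Its trace is the image `Φ(γ[0,∞))` compactified by `b`, where `Φ` is the
boundary extension of the uniformizing map `φ : ℍ → D`: a parameter `t` with `Φ(γ(t)) = z` cannot
have `γ(t)` real (real points go to `∂D` under `Φ`, by the half-plane Carathéodory theorem proved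
in the tree, `JordanDomain.exists_hasBoundaryValue_holds`, while `z ∈ D`), and the terminal
parameter goes to `b ∈ ∂D`; so `γ(t) ∈ ℍ` and `γ(t) = φ⁻¹(z)` by injectivity — a null event
(`measure_mem_range_sleTrace_eq_zero`). For `κ ≥ 8` the statement is false (the trace is onto).
[cite: RohdeSchramm2005, Thm 8.1] -/
theorem measure_mem_range_eq_zero_of_isSLECurve (hκ0 : 0 < κ) (hκ8 : κ < 8)
    (hΓ : IsSLECurve κ D Γ) {z : ℂ} (hz : z ∈ D.carrier) :
    preWienerMeasure {ω | z ∈ (Γ ω).range} = 0 := by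
  have hT := hΓ.hasSLETrace
  obtain ⟨-, φ, -, hae⟩ := hΓ
  have hD : IsOpen D.carrier := D.isOpen
  have hnot1 : D.pt 1 ∉ D.carrier := fun h =>
    (D.pt_mem_frontier 1).2 (by rwa [hD.interior_eq])
  set z₀ : ℂ := φ.symm z with hz₀
  have hz₀H : z₀ ∈ upperHalfPlaneSet := φ.symm_mapsTo hz
  have hφz₀ : φ z₀ = z := φ.apply_symm_apply hz
  have hz₀im : 0 < z₀.im := hz₀H
  have hnull := measure_mem_range_sleTrace_eq_zero hκ0 hκ8 hT hz₀im
  have hbad : preWienerMeasure {ω | ¬ (Loewner.IsGeneratedByCurve (sleDriving κ ω) (sleTrace κ ω) ∧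
      ∃ c : Curve ℂ, Γ ω = CurveClass.mk c ∧
        IsCompactifiedImage φ.boundaryExtension (sleTrace κ ω) (D.pt 1) c)} = 0 :=
    ae_iff.1 hae
  refine measure_mono_null (fun ω hω => ?_) (measure_union_null hnull hbad)
  by_cases hgood : Loewner.IsGeneratedByCurve (sleDriving κ ω) (sleTrace κ ω) ∧
      ∃ c : Curve ℂ, Γ ω = CurveClass.mk c ∧
        IsCompactifiedImage φ.boundaryExtension (sleTrace κ ω) (D.pt 1) c
  · left
    obtain ⟨hgen, c, hc, himg⟩ := hgood
    have hzc : z ∈ c.range := by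
      have h := hω
      simp only [mem_setOf_eq, hc, CurveClass.range_mk] at h
      exact h
    obtain ⟨s, hs⟩ := hzc
    by_cases hs1 : (s : ℝ) < 1
    · rw [himg.1 s hs1] at hs
      by_cases ht : sleTrace κ ω (rayParam s) ∈ upperHalfPlaneSet
      · rw [φ.boundaryExtension_eq ht] at hs
        exact ⟨rayParam s, φ.injOn ht hz₀H (hs.trans hφz₀.symm)⟩
      · exfalso
        -- `γ t` is real, so `Φ (γ t) ∈ ∂D`, but `Φ (γ t) = z ∈ D`
        have him0 : 0 ≤ (sleTrace κ ω (rayParam s)).im := hgen.2.2.1 _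
        have him : (sleTrace κ ω (rayParam s)).im = 0 :=
          le_antisymm (not_lt.1 fun hlt => ht hlt) him0
        obtain ⟨p, hp, hpv⟩ := JordanDomain.exists_hasBoundaryValue_holds D.toJordanDomain φ
          (sleTrace κ ω (rayParam s)).re
        have hx : (((sleTrace κ ω (rayParam s)).re : ℝ) : ℂ) = sleTrace κ ω (rayParam s) :=
          Complex.ext (by simp) (by simp [him])
        have hcl : (((sleTrace κ ω (rayParam s)).re : ℝ) : ℂ) ∈ closure upperHalfPlaneSet := by
          rw [show closure upperHalfPlaneSet = {z : ℂ | 0 ≤ z.im} from Complex.closure_setOf_lt_im 0]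
          simp
        have hΦ := φ.boundaryExtension_eq_of_hasBoundaryValue hcl hpv
        rw [hx] at hΦ
        rw [hΦ] at hs
        exact hp.2 (by rw [hD.interior_eq, hs]; exact hz)
    · exfalso
      rw [unitInterval.eq_one_of_not_lt hs1, himg.2] at hs
      exact hnot1 (hs ▸ hz)
  · right
    exact hgood

end OnePoint

/-! ### The visiting functional: a bounded continuous minorant of "the trace comes within `2r` of `z`" -/

section VisitFunctional

variable {E : Type*} [MetricSpace E]

/-- `V_{z,r} = 1 - F_{z,r}` (`missFunctional`): bounded, continuous, values in `[0, 1]`, equal to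
`1` on curves passing within distance `< r` of `z` and to `0` on curves staying at distance
`≥ 2r` from `z`. [folklore] -/
def visitFunctional (z : E) (r : ℝ) : CurveClass E →ᵇ ℝ :=
  BoundedContinuousFunction.const _ 1 - missFunctional z r

/-- Value of the visiting functional. [folklore] -/
theorem visitFunctional_apply (z : E) (r : ℝ) (c : CurveClass E) :
    visitFunctional z r c = 1 - missFunctional z r c := rfl

/-- `0 ≤ V`. [folklore] -/
theorem visitFunctional_nonneg (z : E) (r : ℝ) (c : CurveClass E) : 0 ≤ visitFunctional z r c := by
  rw [visitFunctional_apply]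
  linarith [missFunctional_le_one z r c]

/-- `V ≤ 1`. [folklore] -/
theorem visitFunctional_le_one (z : E) (r : ℝ) (c : CurveClass E) : visitFunctional z r c ≤ 1 := by
  rw [visitFunctional_apply]
  linarith [missFunctional_nonneg z r c]

/-- `V = 1` on a curve with a point at distance `< r` from `z`. [folklore] -/
theorem visitFunctional_eq_one {z : E} {r : ℝ} (hr : 0 < r) {c : CurveClass E} {y : E}
    (hy : y ∈ c.range) (hyz : dist y z < r) : visitFunctional z r c = 1 := by
  rw [visitFunctional_apply, missFunctional_eq_zero hr hy hyz, sub_zero]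

/-- `V = 0` on a curve at distance `≥ 2r` from `z`. [folklore] -/
theorem visitFunctional_eq_zero {z : E} {r : ℝ} (hr : 0 < r) {c : CurveClass E}
    (h : 2 * r ≤ infDist z c.range) : visitFunctional z r c = 0 := by
  rw [visitFunctional_apply, missFunctional_apply, missProfile_eq_one hr h, sub_self]

end VisitFunctional

/-! ### Lattice side and limit side of the one-point portmanteau step -/

section Sides

variable {Ω : Set ℂ} {δ : ℝ} {a b : Site 2}

/-- **Lattice side**: `P[some visited mesh point lies in B(z, r)] ≤ ∫ V_{z,r}(γ.curve) dP` for
every finite measure `P` on SAWs (a visited mesh point lies on the polyline). [folklore] -/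
theorem measureReal_visits_le_integral {z : ℂ} {r : ℝ} (hr : 0 < r)
    (P : Measure (DomainSAW Ω δ a b)) [IsFiniteMeasure P] :
    (P {γ | ∃ v ∈ γ.walk.support, meshPoint δ v ∈ ball z r}).toReal ≤
      ∫ γ, visitFunctional z r γ.curve ∂P := by
  set S : Set (DomainSAW Ω δ a b) := {γ | ∃ v ∈ γ.walk.support, meshPoint δ v ∈ ball z r}
  have hS : MeasurableSet S := MeasurableSpace.measurableSet_top
  rw [← measureReal_def, ← integral_indicator_one hS]
  refine integral_mono ((integrable_const (1 : ℝ)).indicator hS) ?_ fun γ => ?_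
  · exact Integrable.of_bound (DomainSAW.measurable_of_top _).aestronglyMeasurable 1
      (ae_of_all _ fun γ => by
        rw [Real.norm_eq_abs, abs_of_nonneg (visitFunctional_nonneg _ _ _)]
        exact visitFunctional_le_one _ _ _)
  · by_cases hγ : γ ∈ S
    · obtain ⟨v, hv, hvz⟩ := hγ
      rw [indicator_of_mem (show γ ∈ S from ⟨v, hv, hvz⟩), Pi.one_apply,
        visitFunctional_eq_one hr (meshPoint_mem_range_curve γ hv) (mem_ball.1 hvz)]
    · rw [indicator_of_notMem hγ]
      exact visitFunctional_nonneg _ _ _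

/-- The set of curve classes passing within distance `< s` of `z` is open. [folklore] -/
theorem isOpen_setOf_infDist_range_lt {E : Type*} [MetricSpace E] (z : E) (s : ℝ) :
    IsOpen {c : CurveClass E | infDist z c.range < s} :=
  isOpen_lt (lipschitzWith_infDist_range z).continuous continuous_const

variable {Ω' : Type*} [MeasurableSpace Ω']

/-- **Limit side**: `∫ V_{z,r}(Γ) dW ≤ W[dist(z, trace Γ) < 2r]` for a finite measure `W` and a
measurable random curve class `Γ` (`V_{z,r} = 0` off that event, `≤ 1` on it). [folklore] -/
theorem integral_visitFunctional_le_measureReal {W : Measure Ω'} [IsFiniteMeasure W]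
    {Γ : Ω' → CurveClass ℂ} (hΓ : Measurable Γ) {z : ℂ} {r : ℝ} (hr : 0 < r) :
    ∫ ω, visitFunctional z r (Γ ω) ∂W ≤ (W {ω | infDist z (Γ ω).range < 2 * r}).toReal := by
  set T : Set Ω' := {ω | infDist z (Γ ω).range < 2 * r}
  have hT : MeasurableSet T := (isOpen_setOf_infDist_range_lt z (2 * r)).measurableSet.preimage hΓ
  rw [← measureReal_def, ← integral_indicator_one hT]
  refine integral_mono ?_ ((integrable_const (1 : ℝ)).indicator hT) fun ω => ?_
  · exact Integrable.of_bound
      ((visitFunctional z r).continuous.measurable.comp hΓ).aestronglyMeasurable 1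
      (ae_of_all _ fun ω => by
        rw [Real.norm_eq_abs, abs_of_nonneg (visitFunctional_nonneg _ _ _)]
        exact visitFunctional_le_one _ _ _)
  · by_cases hω : ω ∈ T
    · rw [indicator_of_mem hω, Pi.one_apply]
      exact visitFunctional_le_one _ _ _
    · rw [indicator_of_notMem hω]
      have h2 : 2 * r ≤ infDist z (Γ ω).range := not_lt.1 hω
      rw [visitFunctional_eq_zero hr h2]

end Sides

/-! ### One-point density passes to the limit -/

section General

variable {Ω : Set ℂ} {A B : ℝ → Site 2} {P : ∀ δ : ℝ, Measure (DomainSAW Ω δ (A δ) (B δ))}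
  {Ω' : Type*} [MeasurableSpace Ω'] {W : Measure Ω'} {Γ : Ω' → CurveClass ℂ}

/-- **One-point portmanteau step at a fixed radius.** If the SAW polylines converge in law to a
measurable random curve `Γ` under a finite measure `W`, and the ball `B(z, r)` contains a visited
mesh point with probability eventually `≥ w`, then `W[dist(z, trace Γ) < 2r] ≥ w`.
[cite: Billingsley1999, Thm 2.1] -/
theorem le_measure_infDist_lt_of_tendstoLaw [∀ δ, IsFiniteMeasure (P δ)] [IsFiniteMeasure W]
    (hΓ : Measurable Γ)
    (hT : TendstoLaw (fun δ (γ : DomainSAW Ω δ (A δ) (B δ)) => γ.curve) P Γ W)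
    {z : ℂ} {r : ℝ} (hr : 0 < r) {w : ℝ≥0∞}
    (hw : ∀ᶠ δ in 𝓝[>] (0 : ℝ), w ≤ P δ {γ | ∃ v ∈ γ.walk.support, meshPoint δ v ∈ ball z r}) :
    w ≤ W {ω | infDist z (Γ ω).range < 2 * r} := by
  obtain ⟨δ₀, hδ₀⟩ := hw.exists
  have hwtop : w ≠ ∞ := ne_top_of_le_ne_top (measure_ne_top _ _) hδ₀
  have h1 : w.toReal ≤ ∫ ω, visitFunctional z r (Γ ω) ∂W := by
    refine ge_of_tendsto (hT (visitFunctional z r)) ?_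
    filter_upwards [hw] with δ hδ
    exact (ENNReal.toReal_mono (measure_ne_top _ _) hδ).trans
      (measureReal_visits_le_integral hr (P δ))
  exact (ENNReal.toReal_le_toReal hwtop (measure_ne_top _ _)).1
    (h1.trans (integral_visitFunctional_le_measureReal hΓ hr))

/-- **Positive one-point density passes to the limit.** If at a point `z` every ball `B(z, r)`
contains a visited mesh point with probability eventually `≥ w`, then every limit in law `Γ`
(measurable, under a finite measure `W`) passes through `z` with probability `≥ w`:
`W[z ∈ trace Γ] ≥ w` (the events `{dist(z, trace Γ) < 2/(n+1)}` decrease to `{z ∈ trace Γ}`,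
the trace being compact). The one-point analogue of `IsSpaceFillingLaws.ae_carrier_subset_range`
of `…ProofsNarrow` (`w = 1` at every point gives an a.s. onto limit).
[cite: DuminilCopinKozmaYadin2014, §1 (When x > 1/μ)] -/
theorem le_measure_mem_range_of_tendstoLaw [∀ δ, IsFiniteMeasure (P δ)] [IsFiniteMeasure W]
    (hΓ : Measurable Γ)
    (hT : TendstoLaw (fun δ (γ : DomainSAW Ω δ (A δ) (B δ)) => γ.curve) P Γ W)
    {z : ℂ} {w : ℝ≥0∞}
    (hw : ∀ r : ℝ, 0 < r → ∀ᶠ δ in 𝓝[>] (0 : ℝ),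
      w ≤ P δ {γ | ∃ v ∈ γ.walk.support, meshPoint δ v ∈ ball z r}) :
    w ≤ W {ω | z ∈ (Γ ω).range} := by
  set T : ℕ → Set Ω' := fun n => {ω | infDist z (Γ ω).range < 2 * (1 / ((n : ℝ) + 1))}
    with hTdef
  have hmeas : ∀ n, MeasurableSet (T n) := fun n =>
    (isOpen_setOf_infDist_range_lt z _).measurableSet.preimage hΓ
  have hanti : Antitone T := by
    intro m n hmn ω hω
    simp only [hTdef, mem_setOf_eq] at hω ⊢
    have hle : (1 : ℝ) / ((n : ℝ) + 1) ≤ 1 / ((m : ℝ) + 1) :=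
      one_div_le_one_div_of_le (by positivity) (by exact_mod_cast Nat.succ_le_succ hmn)
    linarith
  have hinter : (⋂ n, T n) = {ω | z ∈ (Γ ω).range} := by
    ext ω
    simp only [mem_iInter, hTdef, mem_setOf_eq]
    constructor
    · intro hall
      have h0 : infDist z (Γ ω).range = 0 := by
        by_contra hne
        have hpos : 0 < infDist z (Γ ω).range := lt_of_le_of_ne infDist_nonneg (Ne.symm hne)
        obtain ⟨n, hn⟩ := exists_nat_one_div_lt (half_pos hpos)
        have := hall n
        linarith
      exact ((Γ ω).isCompact_range.isClosed.mem_iff_infDist_zero (Γ ω).range_nonempty).2 h0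
    · intro hmem n
      rw [infDist_zero_of_mem hmem]
      positivity
  have hlim := tendsto_measure_iInter_atTop (μ := W) (fun n => (hmeas n).nullMeasurableSet) hanti
    ⟨0, measure_ne_top _ _⟩
  rw [hinter] at hlim
  exact ge_of_tendsto hlim (Eventually.of_forall fun n =>
    le_measure_infDist_lt_of_tendstoLaw hΓ hT (by positivity) (hw _ (by positivity)))

end General

/-! ### The one-point theorems: necessity for SLE limits, and the obstruction -/

section Core

variable {κ : ℝ≥0} {D : DobrushinDomain} {A B : ℝ → Site 2}
  {P : ∀ δ : ℝ, Measure (DomainSAW D.carrier δ (A δ) (B δ))}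

open Literature.Probability.Process (preWienerMeasure)

/-- **An SLE_κ limit (`0 < κ < 8`) forces vanishing visiting probabilities at every interior
point.** If the SAW polylines (finite laws `P δ`) converge in law, in the curve topology, to a
chordal SLE_κ random curve of `(D; a, b)` with `κ < 8`, then for every `z ∈ D` and every `w > 0`
there is a radius `r > 0` such that, for all small `δ`, the walk visits a mesh point of `B(z, r)`
with probability `< w`. (The limit misses `z` a.s., `measure_mem_range_eq_zero_of_isSLECurve`;
the events `{dist(z, trace Γ) < 2/(n+1)}` decrease to `{z ∈ trace Γ}`; one-sided portmanteau
with the test functional `visitFunctional z r`.) A necessary condition of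
`Literature.Probability.RandomPlanarGeometry.SAW.SAWScalingLimit` at every interior point, of
Problem-10 type (it implies that no ball is visited with probability `→ 1`).
[cite: DuminilCopinKozmaYadin2014, §4 (Problem 10)] -/
theorem exists_eventually_measure_visits_lt_of_convergesInLawToSLE [∀ δ, IsFiniteMeasure (P δ)]
    (hκ0 : 0 < κ) (hκ8 : κ < 8)
    (h : ConvergesInLawToSLE κ D (fun δ (γ : DomainSAW D.carrier δ (A δ) (B δ)) => γ.curve) P)
    {z : ℂ} (hz : z ∈ D.carrier) {w : ℝ≥0∞} (hw : w ≠ 0) :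
    ∃ r : ℝ, 0 < r ∧ ∀ᶠ δ in 𝓝[>] (0 : ℝ),
      P δ {γ | ∃ v ∈ γ.walk.support, meshPoint δ v ∈ ball z r} < w := by
  obtain ⟨Γ, hΓ, -, hT⟩ := h
  haveI : IsProbabilityMeasure preWienerMeasure :=
    Literature.Probability.Process.isProbabilityMeasure_preWienerMeasure
      isProjectiveLimit_preWienerMeasure_holds
  set W : Measure (ℝ≥0 → ℝ) := preWienerMeasure with hW
  -- a measurable modification of the limit
  have hae := hΓ.aemeasurable.ae_eq_mk
  set Γ' : (ℝ≥0 → ℝ) → CurveClass ℂ := hΓ.aemeasurable.mk Γ with hΓ'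
  have hΓ'm : Measurable Γ' := hΓ.aemeasurable.measurable_mk
  have hT' : TendstoLaw (fun δ (γ : DomainSAW D.carrier δ (A δ) (B δ)) => γ.curve) P Γ' W := by
    intro f
    have h1 := hT f
    have h2 : (fun ω => f (Γ ω)) =ᵐ[W] fun ω => f (Γ' ω) := by
      filter_upwards [hae] with ω hω
      rw [hω]
    rwa [integral_congr_ae h2] at h1
  have hzero : W {ω | z ∈ (Γ' ω).range} = 0 := by
    have h0 := measure_mem_range_eq_zero_of_isSLECurve hκ0 hκ8 hΓ hz
    have hE : ({ω | z ∈ (Γ ω).range} : Set (ℝ≥0 → ℝ)) =ᵐ[W] ({ω | z ∈ (Γ' ω).range} : Set _) := by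
      filter_upwards [hae] with ω hω
      show (z ∈ (Γ ω).range) = (z ∈ (Γ' ω).range)
      rw [hω]
    rw [← measure_congr hE]
    exact h0
  -- the events `{dist(z, trace Γ') < 2/(n+1)}` decrease to `{z ∈ trace Γ'}`
  set T : ℕ → Set (ℝ≥0 → ℝ) := fun n =>
    {ω | infDist z (Γ' ω).range < 2 * (1 / ((n : ℝ) + 1))} with hTdef
  have hmeas : ∀ n, MeasurableSet (T n) := fun n =>
    (isOpen_setOf_infDist_range_lt z _).measurableSet.preimage hΓ'm
  have hanti : Antitone T := by
    intro m n hmn ω hω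
    simp only [hTdef, mem_setOf_eq] at hω ⊢
    have hle : (1 : ℝ) / ((n : ℝ) + 1) ≤ 1 / ((m : ℝ) + 1) :=
      one_div_le_one_div_of_le (by positivity) (by exact_mod_cast Nat.succ_le_succ hmn)
    linarith
  have hinter : (⋂ n, T n) = {ω | z ∈ (Γ' ω).range} := by
    ext ω
    simp only [mem_iInter, hTdef, mem_setOf_eq]
    constructor
    · intro hall
      have h0 : infDist z (Γ' ω).range = 0 := by
        by_contra hne
        have hpos : 0 < infDist z (Γ' ω).range := lt_of_le_of_ne infDist_nonneg (Ne.symm hne)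
        obtain ⟨n, hn⟩ := exists_nat_one_div_lt (half_pos hpos)
        have := hall n
        linarith
      exact ((Γ' ω).isCompact_range.isClosed.mem_iff_infDist_zero
        (Γ' ω).range_nonempty).2 h0
    · intro hmem n
      rw [infDist_zero_of_mem hmem]
      positivity
  have hlim : Tendsto (fun n => W (T n)) atTop (𝓝 0) := by
    have h := tendsto_measure_iInter_atTop (μ := W) (fun n => (hmeas n).nullMeasurableSet) hanti
      ⟨0, measure_ne_top _ _⟩
    rwa [hinter, hzero] at h
  -- choose `n` with `W (T n) < w`, and `r = 1/(n+1)`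
  obtain ⟨n, hn⟩ := (hlim.eventually (gt_mem_nhds (pos_iff_ne_zero.2 hw))).exists
  set r : ℝ := 1 / ((n : ℝ) + 1) with hr
  have hr0 : 0 < r := by positivity
  refine ⟨r, hr0, ?_⟩
  -- `w = ∞` is trivial
  rcases eq_or_ne w ∞ with rfl | hwtop
  · exact Eventually.of_forall fun δ => measure_lt_top _ _
  -- the test integrals converge to `∫ V(Γ') dW ≤ W (T n) < w`
  have hconv := hT' (visitFunctional z r)
  have hlt : ∫ ω, visitFunctional z r (Γ' ω) ∂W < w.toReal :=
    (integral_visitFunctional_le_measureReal hΓ'm hr0).trans_lt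
      ((ENNReal.toReal_lt_toReal (measure_ne_top _ _) hwtop).2 hn)
  filter_upwards [hconv.eventually (gt_mem_nhds hlt)] with δ hδ
  have h1 := (measureReal_visits_le_integral hr0 (P δ)).trans_lt hδ
  exact (ENNReal.toReal_lt_toReal (measure_ne_top _ _) hwtop).1 h1

/-- **The one-point obstruction.** If at ONE interior point `z ∈ D` the SAW laws visit every
ball `B(z, r)` with probability eventually `≥ w > 0` (uniformly in `r`), they do not converge in
law to chordal SLE_κ for any `0 < κ < 8` (sharp: SLE_κ, `κ ≥ 8`, hits every point). The space-filling mechanism of `…Proofs` is the case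
`w = 1` at every point; here a positive-probability dense component at a single point suffices.
[cite: DuminilCopinKozmaYadin2014, §1 (When x > 1/μ)] -/
theorem not_convergesInLawToSLE_of_le_measure_visits [∀ δ, IsFiniteMeasure (P δ)]
    (hκ0 : 0 < κ) (hκ8 : κ < 8) {z : ℂ} (hz : z ∈ D.carrier) {w : ℝ≥0∞} (hw0 : w ≠ 0)
    (hw : ∀ r : ℝ, 0 < r → ∀ᶠ δ in 𝓝[>] (0 : ℝ),
      w ≤ P δ {γ | ∃ v ∈ γ.walk.support, meshPoint δ v ∈ ball z r}) :
    ¬ ConvergesInLawToSLE κ D (fun δ (γ : DomainSAW D.carrier δ (A δ) (B δ)) => γ.curve) P := by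
  intro h
  obtain ⟨r, hr, hlt⟩ := exists_eventually_measure_visits_lt_of_convergesInLawToSLE hκ0 hκ8 h hz hw0
  obtain ⟨δ, hδ₁, hδ₂⟩ := ((hw r hr).and hlt).exists
  exact absurd hδ₂ (not_lt.2 hδ₁)

end Core

/-! ### Fugacity-annealed laws -/

section Annealed

variable {Ω : Set ℂ} {δ : ℝ} {a b : Site 2}

/-- The space of SAWs of `Ω_δ` between two sites is countable (a walk is determined by its
support, a list of sites). [folklore] -/
instance instCountableDomainSAW : Countable (DomainSAW Ω δ a b) := by
  have hinj : Function.Injective fun γ : DomainSAW Ω δ a b => γ.walk.support := by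
    intro γ γ' h
    have hw : γ.walk = γ'.walk := SimpleGraph.Walk.support_injective h
    cases γ; cases γ'; cases hw; rfl
  exact hinj.countable

/-- Singletons are measurable (discrete σ-algebra). [folklore] -/
instance instMeasurableSingletonClassDomainSAW : MeasurableSingletonClass (DomainSAW Ω δ a b) :=
  ⟨fun _ => MeasurableSpace.measurableSet_top⟩

/-- `x ↦ Σ_{γ ∈ S} x^{|γ|}` (as an `ℝ≥0∞`-valued weight) is measurable in the fugacity.
[cite: DuminilCopinKozmaYadin2014, §1 (definition of P_{(Ω_δ,a_δ,b_δ,x)})] -/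
theorem measurable_weightAt_apply (S : Set (DomainSAW Ω δ a b)) :
    Measurable fun x : ℝ => weightAt x Ω δ a b S := by
  have h : (fun x : ℝ => weightAt x Ω δ a b S) =
      fun x => ∑' γ : DomainSAW Ω δ a b, ENNReal.ofReal (x ^ γ.length) * Measure.dirac γ S := by
    funext x
    rw [weightAt, Measure.sum_apply _ MeasurableSpace.measurableSet_top]
    simp only [Measure.smul_apply, smul_eq_mul]
  rw [h]
  refine Measurable.tsum fun γ => ?_
  exact (ENNReal.measurable_ofReal.comp (measurable_id.pow_const _)).mul_const _

/-- `x ↦ P_{(Ω_δ,a,b,x)}(S)` is measurable in the fugacity.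
[cite: DuminilCopinKozmaYadin2014, §1 (definition of P_{(Ω_δ,a_δ,b_δ,x)})] -/
theorem measurable_lawAt_apply (S : Set (DomainSAW Ω δ a b)) :
    Measurable fun x : ℝ => lawAt x Ω δ a b S := by
  have h : (fun x : ℝ => lawAt x Ω δ a b S) =
      fun x => (weightAt x Ω δ a b univ)⁻¹ * weightAt x Ω δ a b S := by
    funext x
    rw [lawAt, Measure.smul_apply, smul_eq_mul]
  rw [h]
  exact (measurable_weightAt_apply univ).inv.mul (measurable_weightAt_apply S)

/-- `P_{(Ω_δ,a,b,x)}` has total mass `≤ 1` (it is `0` or a probability measure).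
[cite: DuminilCopinKozmaYadin2014, §1 (definition of P_{(Ω_δ,a_δ,b_δ,x)})] -/
theorem lawAt_univ_le_one (x : ℝ) (Ω : Set ℂ) (δ : ℝ) (a b : Site 2) :
    lawAt x Ω δ a b univ ≤ 1 := by
  rcases lawAt_eq_zero_or_isProbabilityMeasure x Ω δ a b with h | h
  · rw [h]
    simp
  · exact prob_le_one

/-- **The fugacity-annealed SAW law**: for a (prior) measure `ρ` on fugacities,
`P^ρ_{(Ω_δ,a,b)} = ∫ P_{(Ω_δ,a,b,x)} ρ(dx)`, the law of the walk when the parameter `x` is first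
drawn from `ρ` (defined atom by atom; `annealedLaw_apply`). The class of statements "robust in
`x`" by averaging rather than by quantifying. [cite: DuminilCopinKozmaYadin2014, §1 (definition of P_{(Ω_δ,a_δ,b_δ,x)})] -/
def annealedLaw (ρ : Measure ℝ) (Ω : Set ℂ) (δ : ℝ) (a b : Site 2) : Measure (DomainSAW Ω δ a b) :=
  Measure.sum fun γ => (∫⁻ x, lawAt x Ω δ a b {γ} ∂ρ) • Measure.dirac γ

/-- `P^ρ(S) = ∫ P_x(S) ρ(dx)` for every event `S`. [folklore] -/
theorem annealedLaw_apply (ρ : Measure ℝ) (S : Set (DomainSAW Ω δ a b)) :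
    annealedLaw ρ Ω δ a b S = ∫⁻ x, lawAt x Ω δ a b S ∂ρ := by
  classical
  have hS : MeasurableSet S := MeasurableSpace.measurableSet_top
  rw [annealedLaw, Measure.sum_apply _ hS]
  simp only [Measure.smul_apply, smul_eq_mul, Measure.dirac_apply' _ hS]
  calc ∑' γ : DomainSAW Ω δ a b, (∫⁻ x, lawAt x Ω δ a b {γ} ∂ρ) * S.indicator 1 γ
      = ∑' γ : DomainSAW Ω δ a b, ∫⁻ x, S.indicator (fun γ => lawAt x Ω δ a b {γ}) γ ∂ρ := by
        refine tsum_congr fun γ => ?_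
        by_cases hγ : γ ∈ S
        · simp only [indicator_of_mem hγ, Pi.one_apply, mul_one]
        · simp only [indicator_of_notMem hγ, mul_zero, lintegral_zero]
    _ = ∫⁻ x, ∑' γ : DomainSAW Ω δ a b, S.indicator (fun γ => lawAt x Ω δ a b {γ}) γ ∂ρ := by
        rw [lintegral_tsum fun γ => ?_]
        by_cases hγ : γ ∈ S
        · simp only [indicator_of_mem hγ]
          exact (measurable_lawAt_apply _).aemeasurable
        · simp only [indicator_of_notMem hγ]
          exact aemeasurable_const
    _ = ∫⁻ x, lawAt x Ω δ a b S ∂ρ := by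
        refine lintegral_congr fun x => ?_
        exact Measure.tsum_indicator_apply_singleton _ _ hS

/-- With a Dirac prior the annealed law is the law with that fugacity (`P^{δ_x} = P_x`): the
annealed class contains every fixed-fugacity statement. [folklore] -/
theorem annealedLaw_dirac (x : ℝ) (Ω : Set ℂ) (δ : ℝ) (a b : Site 2) :
    annealedLaw (Measure.dirac x) Ω δ a b = lawAt x Ω δ a b := by
  ext S _
  rw [annealedLaw_apply, lintegral_dirac' _ (measurable_lawAt_apply S)]

/-- The annealed law has mass `≤ ρ(ℝ)`. [folklore] -/
theorem annealedLaw_univ_le (ρ : Measure ℝ) (Ω : Set ℂ) (δ : ℝ) (a b : Site 2) :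
    annealedLaw ρ Ω δ a b univ ≤ ρ univ := by
  rw [annealedLaw_apply]
  calc ∫⁻ x, lawAt x Ω δ a b univ ∂ρ ≤ ∫⁻ _, 1 ∂ρ := lintegral_mono fun x => lawAt_univ_le_one x Ω δ a b
    _ = ρ univ := by rw [lintegral_one]

/-- For a finite prior the annealed law is a finite measure. [folklore] -/
instance isFiniteMeasure_annealedLaw (ρ : Measure ℝ) [IsFiniteMeasure ρ] (Ω : Set ℂ) (δ : ℝ)
    (a b : Site 2) : IsFiniteMeasure (annealedLaw ρ Ω δ a b) :=
  ⟨(annealedLaw_univ_le ρ Ω δ a b).trans_lt (measure_lt_top _ _)⟩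

/-- **Fatou lower bound for annealed probabilities.** If for `ρ`-almost every `x` in a measurable
set `I` of fugacities the probability of the events `S δ` under `P_x` tends to `1` as `δ → 0⁺`,
then for every `w < ρ(I)` eventually `P^ρ(S δ) ≥ w`. [folklore] -/
theorem eventually_le_annealedLaw {ρ : Measure ℝ} {I : Set ℝ} (hI : MeasurableSet I)
    {A B : ℝ → Site 2} (S : ∀ δ : ℝ, Set (DomainSAW Ω δ (A δ) (B δ)))
    (hS : ∀ x ∈ I, Tendsto (fun δ => lawAt x Ω δ (A δ) (B δ) (S δ)) (𝓝[>] 0) (𝓝 1))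
    {w : ℝ≥0∞} (hw : w < ρ I) :
    ∀ᶠ δ in 𝓝[>] (0 : ℝ), w ≤ annealedLaw ρ Ω δ (A δ) (B δ) (S δ) := by
  by_contra hnot
  have hfreq : ∃ᶠ δ in 𝓝[>] (0 : ℝ), annealedLaw ρ Ω δ (A δ) (B δ) (S δ) < w := by
    simpa only [not_eventually, not_le] using hnot
  obtain ⟨u, hu, hlt⟩ := exists_seq_forall_of_frequently hfreq
  -- Fatou along the sequence `u n → 0⁺` for the functions `1_I(x) P_x(S (u n))`
  set f : ℕ → ℝ → ℝ≥0∞ := fun n x => I.indicator (fun x => lawAt x Ω (u n) (A (u n)) (B (u n)) (S (u n))) x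
    with hf
  have hfm : ∀ n, AEMeasurable (f n) ρ := fun n =>
    ((measurable_lawAt_apply _).indicator hI).aemeasurable
  have hfatou := lintegral_liminf_le' (u := (atTop : Filter ℕ)) hfm
  -- left side: `ρ I ≤ ∫ liminf f n`
  have hleft : ρ I ≤ ∫⁻ x, liminf (fun n => f n x) atTop ∂ρ := by
    rw [← lintegral_indicator_one hI]
    refine lintegral_mono fun x => ?_
    by_cases hx : x ∈ I
    · simp only [hf, indicator_of_mem hx, Pi.one_apply]
      have ht : Tendsto (fun n => lawAt x Ω (u n) (A (u n)) (B (u n)) (S (u n))) atTop (𝓝 1) :=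
        (hS x hx).comp hu
      rw [ht.liminf_eq]
    · simp only [hf, indicator_of_notMem hx]
      exact bot_le
  -- right side: `liminf ∫ f n ≤ w`
  have hun : ∀ n, ∫⁻ x, f n x ∂ρ ≤ w := fun n =>
    calc ∫⁻ x, f n x ∂ρ ≤ ∫⁻ x, lawAt x Ω (u n) (A (u n)) (B (u n)) (S (u n)) ∂ρ :=
          lintegral_mono fun x => indicator_le_self _ _ _
      _ = annealedLaw ρ Ω (u n) (A (u n)) (B (u n)) (S (u n)) := (annealedLaw_apply ρ _).symm
      _ ≤ w := (hlt n).le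
  have hright : liminf (fun n => ∫⁻ x, f n x ∂ρ) atTop ≤ w := by
    refine liminf_le_of_le (by isBoundedDefault) fun b hb => ?_
    obtain ⟨n, hn⟩ := hb.exists
    exact hn.trans (hun n)
  exact absurd ((hleft.trans hfatou).trans hright) (not_le.2 hw)

end Annealed

/-! ### The supercritical and the annealed walk of the unit disc -/

section Disc

variable {A B : ℝ → Site 2}

/-- `8/3 < 8` in `ℝ≥0`. [folklore] -/
theorem eight_thirds_lt_eight : (8 : ℝ≥0) / 3 < 8 := by
  rw [div_lt_iff₀ (by norm_num : (0 : ℝ≥0) < 3)]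
  norm_num

/-- For `x > x_c`, in `(𝔻; 1, -1)` with closest-site endpoints, the fugacity-`x` walk visits
every ball of the disc with probability `→ 1` (Theorem 1 of the source, proved in the tree,
through the weak space-filling of §1, and the laws being probability measures for `δ > 0`).
[cite: DuminilCopinKozmaYadin2014, Theorem 1] -/
theorem tendsto_lawAt_visits_of_lt {x : ℝ} (hx : criticalFugacity < x)
    (hAB : ∀ δ : ℝ, 0 < δ → IsClosestSite unitDisk δ 1 (A δ) ∧ IsClosestSite unitDisk δ (-1) (B δ))
    {z : ℂ} {r : ℝ} (hr : 0 < r) (hball : ball z r ⊆ unitDisk) :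
    Tendsto (fun δ => lawAt x unitDisk δ (A δ) (B δ)
        {γ | ∃ v ∈ γ.walk.support, meshPoint δ v ∈ ball z r}) (𝓝[>] 0) (𝓝 1) := by
  have hne : (1 : ℂ) ≠ -1 := fun h => by
    have h' := congrArg Complex.re h
    norm_num at h'
  have hfill := isSpaceFillingFamily_of_DKY2014_thm1 DKY2014_thm1_holds (by simp) (by simp) hne hAB hx
  have h0 := hfill (ball z r) isOpen_ball hball ⟨z, mem_ball_self hr⟩
  have hx0 : 0 < x := criticalFugacity_pos.trans hx
  have hev : (fun δ => lawAt x unitDisk δ (A δ) (B δ)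
      {γ | ∃ v ∈ γ.walk.support, meshPoint δ v ∈ ball z r}) =ᶠ[𝓝[>] (0 : ℝ)]
      fun δ => 1 - lawAt x unitDisk δ (A δ) (B δ) {γ | ∀ v ∈ γ.walk.support, meshPoint δ v ∉ ball z r} := by
    filter_upwards [self_mem_nhdsWithin] with δ hδ
    have hδ' : 0 < δ := hδ
    haveI := isProbabilityMeasure_lawAt hδ' (hAB δ hδ').1.1 (hAB δ hδ').2.1 hx0
    have hcompl : ({γ | ∃ v ∈ γ.walk.support, meshPoint δ v ∈ ball z r} :
        Set (DomainSAW unitDisk δ (A δ) (B δ))) =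
        {γ | ∀ v ∈ γ.walk.support, meshPoint δ v ∉ ball z r}ᶜ := by
      ext γ
      simp only [mem_setOf_eq, mem_compl_iff, not_forall, not_not, exists_prop]
    rw [hcompl, prob_compl_eq_one_sub MeasurableSpace.measurableSet_top]
  have h1 : Tendsto (fun δ => 1 - lawAt x unitDisk δ (A δ) (B δ)
      {γ | ∀ v ∈ γ.walk.support, meshPoint δ v ∉ ball z r}) (𝓝[>] 0) (𝓝 (1 - 0)) :=
    ENNReal.Tendsto.sub tendsto_const_nhds h0 (Or.inl ENNReal.one_ne_top)
  rw [tsub_zero] at h1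
  exact h1.congr' hev.symm

/-- **The supercritical walk, one-point form**: for `x > x_c` the obstruction hypothesis of
`not_convergesInLawToSLE_of_le_measure_visits` holds at the centre of the disc with `w = 1/2`
(any `w < 1`), recovering `not_convergesInLawToSLE_supercritical_unitDisc_of_lt_eight'`-type conclusions of
`…Unconditional` / `…BelowEight` from a single point. [cite: DuminilCopinKozmaYadin2014, Theorem 1] -/
theorem not_convergesInLawToSLE_supercritical_unitDisc_onePoint {x : ℝ} (hx : criticalFugacity < x)
    {κ : ℝ≥0} (hκ0 : 0 < κ) (hκ8 : κ < 8)
    (hAB : ∀ δ : ℝ, 0 < δ → IsClosestSite unitDisk δ 1 (A δ) ∧ IsClosestSite unitDisk δ (-1) (B δ)) :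
    ¬ ConvergesInLawToSLE κ DobrushinDomain.unitDisc
        (fun δ (γ : DomainSAW DobrushinDomain.unitDisc.carrier δ (A δ) (B δ)) => γ.curve)
        (fun δ => lawAt x DobrushinDomain.unitDisc.carrier δ (A δ) (B δ)) := by
  refine not_convergesInLawToSLE_of_le_measure_visits hκ0 hκ8 (z := 0)
    (by show (0 : ℂ) ∈ unitDisk; simp [unitDisk]) (w := 1 / 2) (by norm_num) fun r hr => ?_
  -- shrink the ball into the disc
  have hsub : ball (0 : ℂ) (min r 1) ⊆ unitDisk := fun y hy => by
    show y ∈ ball (0 : ℂ) 1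
    exact ball_subset_ball (min_le_right _ _) hy
  have ht := tendsto_lawAt_visits_of_lt hx hAB (lt_min hr one_pos) hsub
  have hev := ht.eventually (lt_mem_nhds (show (1 : ℝ≥0∞) / 2 < 1 by norm_num))
  filter_upwards [hev] with δ hδ
  refine hδ.le.trans (measure_mono fun γ hγ => ?_)
  obtain ⟨v, hv, hvz⟩ := hγ
  exact ⟨v, hv, ball_subset_ball (min_le_left _ _) hvz⟩

/-- **Fugacity-annealed laws charging the supercritical phase converge to no SLE_κ, `κ < 8`.**
For a finite prior `ρ` with `ρ((x_c, ∞)) > 0`, the annealed SAW laws `∫ P_{(𝔻_δ,a_δ,b_δ,x)} ρ(dx)`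
of `(𝔻; 1, -1)` (closest-site endpoints) visit every ball around the centre with probability
eventually `≥ ρ((x_c,∞))/2` (Theorem 1 at each `x > x_c`, Fatou), hence converge in law to no
chordal SLE_κ with `0 < κ < 8` — in particular not to SLE_{8/3}: the critical fugacity cannot
be smeared by a prior. [cite: DuminilCopinKozmaYadin2014, Theorem 1] -/
theorem not_convergesInLawToSLE_annealed_unitDisc {ρ : Measure ℝ} [IsFiniteMeasure ρ]
    (hρ : ρ (Ioi criticalFugacity) ≠ 0) {κ : ℝ≥0} (hκ0 : 0 < κ) (hκ8 : κ < 8)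
    (hAB : ∀ δ : ℝ, 0 < δ → IsClosestSite unitDisk δ 1 (A δ) ∧ IsClosestSite unitDisk δ (-1) (B δ)) :
    ¬ ConvergesInLawToSLE κ DobrushinDomain.unitDisc
        (fun δ (γ : DomainSAW DobrushinDomain.unitDisc.carrier δ (A δ) (B δ)) => γ.curve)
        (fun δ => annealedLaw ρ DobrushinDomain.unitDisc.carrier δ (A δ) (B δ)) := by
  have hw0 : ρ (Ioi criticalFugacity) / 2 ≠ 0 :=
    (ENNReal.div_pos_iff.2 ⟨hρ, by norm_num⟩).ne'
  have hw : ρ (Ioi criticalFugacity) / 2 < ρ (Ioi criticalFugacity) :=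
    ENNReal.half_lt_self hρ (measure_ne_top _ _)
  refine not_convergesInLawToSLE_of_le_measure_visits hκ0 hκ8 (z := 0)
    (by show (0 : ℂ) ∈ unitDisk; simp [unitDisk]) hw0 fun r hr => ?_
  have hsub : ball (0 : ℂ) (min r 1) ⊆ unitDisk := fun y hy => by
    show y ∈ ball (0 : ℂ) 1
    exact ball_subset_ball (min_le_right _ _) hy
  have hev := eventually_le_annealedLaw (Ω := unitDisk) (ρ := ρ) measurableSet_Ioi
    (fun δ => {γ : DomainSAW unitDisk δ (A δ) (B δ) | ∃ v ∈ γ.walk.support, meshPoint δ v ∈ ball 0 (min r 1)})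
    (fun x hx => tendsto_lawAt_visits_of_lt hx hAB (lt_min hr one_pos) hsub) hw
  filter_upwards [hev] with δ hδ
  refine hδ.trans (measure_mono fun γ hγ => ?_)
  obtain ⟨v, hv, hvz⟩ := hγ
  exact ⟨v, hv, ball_subset_ball (min_le_left _ _) hvz⟩

/-- **No annealed form of the sub-problem with supercritical mass.** For a finite prior `ρ`
charging `(x_c, ∞)`, the annealed analogue of `SAWScalingLimit` — SLE_{8/3} convergence of
`∫ P_{(Ω_δ,a_δ,b_δ,x)} ρ(dx)` for every Dobrushin domain and endpoint approximation — is false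
(instance `(𝔻; 1, -1)` with closest sites). With `ρ = δ_x`, `x > x_c`, this is
`not_sawScalingLimitAt_of_lt` of `…Unconditional` (`annealedLaw_dirac`).
[cite: DuminilCopinKozmaYadin2014, Theorem 1] -/
theorem not_forall_convergesInLawToSLE_annealed {ρ : Measure ℝ} [IsFiniteMeasure ρ]
    (hρ : ρ (Ioi criticalFugacity) ≠ 0) :
    ¬ ∀ (D : DobrushinDomain) (A B : ℝ → Site 2), IsEndpointApprox D A B →
      ConvergesInLawToSLE ((8 : ℝ≥0) / 3) D
        (fun δ (γ : DomainSAW D.carrier δ (A δ) (B δ)) => γ.curve)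
        (fun δ => annealedLaw ρ D.carrier δ (A δ) (B δ)) := by
  intro h
  obtain ⟨A, hA⟩ := exists_closestSiteFamily (1 : ℂ)
  obtain ⟨B, hB⟩ := exists_closestSiteFamily (-1 : ℂ)
  have hAB : ∀ δ : ℝ, 0 < δ →
      IsClosestSite unitDisk δ 1 (A δ) ∧ IsClosestSite unitDisk δ (-1) (B δ) :=
    fun δ hδ => ⟨hA δ hδ, hB δ hδ⟩
  exact not_convergesInLawToSLE_annealed_unitDisc hρ (by positivity)
    eight_thirds_lt_eight hAB
    (h DobrushinDomain.unitDisc A B (isEndpointApprox_unitDisc_of_isClosestSite hAB))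

/-- **Necessity for the sub-problem**: under `SAWScalingLimit`, in every Dobrushin domain with
an endpoint approximation the critical walk visits small balls around any interior point with
eventually small probability: `∀ w > 0 ∃ r > 0`, `P_{(Ω_δ,a_δ,b_δ,x_c)}[γ_δ ∩ B(z,r) ≠ ∅] < w`
for all small `δ` — a quantitative strengthening, at each point, of the non-space-filling asked
for in Problem 10. [cite: DuminilCopinKozmaYadin2014, §4 (Problem 10)] -/
theorem exists_eventually_law_visits_lt_of_sawScalingLimit (h : SAWScalingLimit)
    (D : DobrushinDomain) (A B : ℝ → Site 2) (hAB : IsEndpointApprox D A B) {z : ℂ}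
    (hz : z ∈ D.carrier) {w : ℝ≥0∞} (hw : w ≠ 0) :
    ∃ r : ℝ, 0 < r ∧ ∀ᶠ δ in 𝓝[>] (0 : ℝ),
      law D.carrier δ (A δ) (B δ) {γ | ∃ v ∈ γ.walk.support, meshPoint δ v ∈ ball z r} < w :=
  exists_eventually_measure_visits_lt_of_convergesInLawToSLE (κ := (8 : ℝ≥0) / 3)
    (P := fun δ => law D.carrier δ (A δ) (B δ)) (by positivity)
    eight_thirds_lt_eight (h D A B hAB) hz hw

end Disc

end SupercriticalSAW

open SupercriticalSAW

/-- **Barrier `SupercriticalSAWSpaceFilling`, one-point form and annealed class (audit gen 14).**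
(1) For every Dobrushin domain `D`, lattice endpoints `A δ, B δ`, finite SAW laws `P δ`, every
`0 < κ < 8`, every interior point `z ∈ D` and `w > 0`: if every ball `B(z, r)` contains a visited
mesh point with `P δ`-probability eventually `≥ w`, the polylines do not converge in law to
chordal SLE_κ in `(D; a, b)`. (2) For every finite prior `ρ` on fugacities with
`ρ((x_c, ∞)) > 0`, every `0 < κ < 8` and closest-site endpoints of `(𝔻; 1, -1)`, the
`ρ`-annealed laws `∫ P_{(𝔻_δ,a_δ,b_δ,x)} ρ(dx)` do not converge in law to chordal SLE_κ.

BARRIER (structured block, D-0021):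
- technique_class: (a) ONE-POINT DENSE families — any family of SAW laws (any finite laws on the walks of `Ω_δ` between `A δ` and `B δ`, not only the fugacity laws) which at a single interior point `z` visits every ball `B(z, r)` with probability eventually `≥ w > 0`, `w` independent of `r`; (b) the fugacity-ANNEALED class — conclusions about `P^ρ_δ = ∫ P_{(Ω_δ,a_δ,b_δ,x)} ρ(dx)` for a prior `ρ` with `ρ((x_c, ∞)) > 0` ("`μ(ℤ²)` is unknown, randomise the fugacity"), which is of type (a) with `w = ρ((x_c,∞))` by Theorem 1 at each `x > x_c` [cite: DuminilCopinKozmaYadin2014, Theorem 1] and Fatou (`SupercriticalSAW.eventually_le_annealedLaw`); (a) contains the weakly space-filling families of `…Proofs` (`w = 1` at every point)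
- blocks: convergence in law, in the curve topology, of any type-(a) family to chordal SLE_κ for any `0 < κ < 8` (`SupercriticalSAW.not_convergesInLawToSLE_of_le_measure_visits`), in particular of the annealed laws of `(𝔻; 1, -1)` (`SupercriticalSAW.not_convergesInLawToSLE_annealed_unitDisc`) and the annealed analogue of `SAWScalingLimit` (`SupercriticalSAW.not_forall_convergesInLawToSLE_annealed`); contrapositively (`SupercriticalSAW.exists_eventually_measure_visits_lt_of_convergesInLawToSLE`, `SupercriticalSAW.exists_eventually_law_visits_lt_of_sawScalingLimit`) the sub-problem REQUIRES `lim_{r→0} limsup_{δ→0} P_{(Ω_δ,a_δ,b_δ,x_c)}[γ_δ ∩ B(z,r) ≠ ∅] = 0` at every interior `z` of every Dobrushin domain — a necessary condition of Problem-10 type [cite: DuminilCopinKozmaYadin2014, §4 (Problem 10)]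
- because: a chordal SLE_κ curve, `κ < 8`, misses each given interior point almost surely (`SupercriticalSAW.measure_mem_range_eq_zero_of_isSLECurve`: one-point estimate [cite: RohdeSchramm2005, Thm 8.1] proved in the tree, half-plane Carathéodory theorem proved in the tree, injectivity of the uniformizing map), whereas positive one-point density passes to limits in law (`SupercriticalSAW.le_measure_mem_range_of_tendstoLaw`: one-sided portmanteau with `1 - missFunctional z r` [cite: Billingsley1999, Thm 2.1], continuity from above over `r ↓ 0`, compact traces)
- evasions_known: priors charging only `(0, x_c]` are not covered by (2) — a prior with `ρ((0, x_c)) > 0` is dead in substance (the subcritical part of any limit is carried by rectifiable curves, `…SubcriticalLength`, and an SLE_κ trace has dimension `1 + κ/8 > 1` [cite: Beffara2008, Thm 1]) but by no declaration (the tree proves the upper dimension bound only), so what is machine-checked is "an SLE_κ (`κ < 8`) limit of the `ρ`-annealed walk forces `ρ((x_c,∞)) = 0`", not "`ρ = δ_{x_c}`"; `δ`-dependent priors `ρ_δ ⇒ δ_{x_c}` are the window class (i) of `SupercriticalSAWSpaceFillingNarrow`; for `κ ≥ 8` the one-point hypothesis holds for the predicted SLE₈ limit itself [cite: DuminilCopinKozmaYadin2014,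 §4 (Smirnov's SLE₈ prediction, p. 8)] and obstructs nothing (consistent with `SupercriticalSAWSpaceFillingPhases`); conclusions about annealed laws that are COMPATIBLE with a positive-probability onto component (tightness, subsequential limits, reversibility — cf. evasion (vii) of the parent) are untouched
- scope_caveats: (1) is for any Dobrushin domain, any lattice endpoints and any finite laws, at INTERIOR points `z ∈ D` only (nothing is asserted at boundary points); (2) is proved for the unit disk with closest-site endpoints of `(1, -1)` (the vendored setting of Theorem 1, `DKY2014_thm1_holds`) and finite priors (`IsFiniteMeasure ρ`; `ρ` need not be a probability measure, fugacities `x ≤ 0` are junk for `lawAt` and contribute mass `≤ ρ((-∞,0])` of zero-or-probability laws, harmless); the quantitative content at `x_c` (the predicted one-point decay `P_{x_c}[γ_δ ∩ B(z,r) ≠ ∅] ≍ r^{2/3}`, exponent `2 - 4/3` [cite: LawlerSchrammWerner2004SAW, Prediction 2]) is not touched — only the qualitative limit `→ 0` is shown necessary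
- status: established (proved here: `SupercriticalSAWSpaceFillingAnnealed_holds`, axioms `propext`, `Classical.choice`, `Quot.sound`); audit gen 14 of `…Proofs` 2026-08-16: parent barrier CONFIRMED at page level (arXiv:1110.3074 p. 2: the weak space-filling sense and Theorem 1 verbatim; p. 8: Problems 9–10 and Smirnov's SLE₈ prediction; axiom closures of `SupercriticalSAWSpaceFilling_holds` and `SupercriticalSAW.not_robustSAWScalingLimit` re-checked; forward citations 27, newest Ann. Probab. 54 (2026) [cite: KrachunPanagiotis2026], none evading; zbMATH "self-avoiding walk" 2025–2026: 38 items, none on supercritical planar scaling limits or Problem 10) and STRENGTHENED by the one-point form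

[cite: DuminilCopinKozmaYadin2014, Theorem 1] -/
def SupercriticalSAWSpaceFillingAnnealed : Prop :=
  (∀ (κ : ℝ≥0) (D : DobrushinDomain) (A B : ℝ → Site 2)
      (P : ∀ δ : ℝ, Measure (DomainSAW D.carrier δ (A δ) (B δ))) [∀ δ, IsFiniteMeasure (P δ)],
      0 < κ → κ < 8 → ∀ z ∈ D.carrier, ∀ w : ℝ≥0∞, w ≠ 0 →
        (∀ r : ℝ, 0 < r → ∀ᶠ δ in 𝓝[>] (0 : ℝ),
          w ≤ P δ {γ | ∃ v ∈ γ.walk.support, meshPoint δ v ∈ ball z r}) →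
        ¬ ConvergesInLawToSLE κ D (fun δ (γ : DomainSAW D.carrier δ (A δ) (B δ)) => γ.curve) P) ∧
  (∀ (ρ : Measure ℝ) [IsFiniteMeasure ρ], ρ (Ioi criticalFugacity) ≠ 0 →
      ∀ (κ : ℝ≥0), 0 < κ → κ < 8 → ∀ A B : ℝ → Site 2,
        (∀ δ : ℝ, 0 < δ → IsClosestSite unitDisk δ 1 (A δ) ∧ IsClosestSite unitDisk δ (-1) (B δ)) →
        ¬ ConvergesInLawToSLE κ DobrushinDomain.unitDisc
            (fun δ (γ : DomainSAW DobrushinDomain.unitDisc.carrier δ (A δ) (B δ)) => γ.curve)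
            (fun δ => annealedLaw ρ DobrushinDomain.unitDisc.carrier δ (A δ) (B δ)))

/-- The one-point / annealed entry holds (proved above). [cite: DuminilCopinKozmaYadin2014, Theorem 1] -/
theorem SupercriticalSAWSpaceFillingAnnealed_holds : SupercriticalSAWSpaceFillingAnnealed :=
  ⟨fun _ _ _ _ _ _ hκ0 hκ8 _ hz _ hw0 hw =>
      not_convergesInLawToSLE_of_le_measure_visits hκ0 hκ8 hz hw0 hw,
    fun _ _ hρ _ hκ0 hκ8 _ _ hAB => not_convergesInLawToSLE_annealed_unitDisc hρ hκ0 hκ8 hAB⟩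

end Literature.Barriers.CriticalPhenomena
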